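/-
Copyright (c) 2026 the pub-hodgecm-mathlib formalisation cell (harness21).  Prover seat hodgecm-mathlib-K2E1-p13 (g5), Track B ∕ K2-LIT, h413 = `stmt-HodgeConjecture-24833`,
R90-TF section S8 «ContSpec-n½» (dealer R90-CS-plan (g3), deals S8-R150 (3) ∕ S8-R152 (e); census `R90/S8/CENSUS-ArchIwasawaKPartU21.K2E1-p13-g5.md`): the ARCHIMEDEAN DICTIONARY —
the `K_∞ ≅ U(2)×U(1)`-part of the `U(2,1)` big cell `Φ₃ · u(X, Z)` at a complex place, in closed form.
-/
import Literature.NumberTheory.Automorphic.IwasawaDecompositionArchUnitary                  -- ★ `U(J₃)(𝕜) = B⁺·K_∞` (`exists_upperTriangularPos_mul_unitary_of_mem`), `mem_unitaryGroupOfForm_starRingEnd_iff`, `star_antidiagonal_over`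
import Literature.NumberTheory.QuadraticForms.HermitianUnimodularRankThreeRamified         -- ★ `antidiagonal_three_over` (`Φ₃` as an explicit matrix)
import Summits.HodgeConjecture.HodgeConjecture.Theorems.K2E1BigCellIwasawaTorusEntrySplitU3  -- ★ p863467 (this seat): field-generic `borel_mul_apply_two`, `weylLong_mul_heis_val`
import HarnessLib

/-!
# K2·E1 ∕ R90·S8 — `K2E1ArchIwasawaKPartU21`: THE `K_∞`-PART OF THE `U(2,1)` BIG CELL AT A COMPLEX PLACE — for EVERY factorisation `Φ₃·u(X,Z) = b·k` (`b ∈ B⁺`, `k ∈ K_∞ = U(Φ₃) ∩ U(3)`):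
# `b = diag-part (|1−Z|⁻¹, 1, |1−Z|)`, `u(k) = k₀₀ − k₀₂ = −(1−Z)∕|1−Z|` (the `U(1)`-factor), `det k = −1`; hence `(det^a ⊗ u^c)(k) = (−1)^{a+c}·((1−Z)∕|1−Z|)^c` — ONE integer, NO `X`-phase

Cell `pub/hodgecm-mathlib`, crux h413 = `stmt-HodgeConjecture-24833`, route of record `HCCMUnconditional`; R90-TF section S8 «ContSpec-n½», road R2-χ₃ (archimedean half of ★ F5's
binder `hA32`; consumers: R90-CS-p03's (4b) letter `hdict` — `K2E1ChiArchBetaFactorU3` ∕ ★ `K2E1ChiArchBetaNonvanishingU3` —, K2E1-p11's FILE 3 `R90S8ChiSectionPairArchSection` (last-row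
section), K2E2-p12's (V) assembly row `ω_∞`).  THEOREMS ONLY (no `def`, no `instance`, no notation, no named-fact hypothesis, no `sorry`; default heartbeats); lane
`--supports stmt-HodgeConjecture-24833 --as helper` (count-neutral).  Closes no socket.  `RCLike 𝕜` (`𝕜 = ℂ` = a complex place `w` of the CM field), currency of ★
`IwasawaDecompositionArchUnitary`: `G = unitaryGroupOfForm (starRingEnd 𝕜) Φ₃`, `Φ₃ = (StdForm.antidiagonal 3).over 𝕜 = antidiag(1,1,1)`, `K_∞ = G ∩ Matrix.unitaryGroup`, `B⁺` = upper
triangular with positive real diagonal (EXISTENCE and UNIQUENESS of `g = b·k` are ★ there; THIS FILE proves closed-form IDENTITIES valid for every such factorisation).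

THE MATHEMATICS ([Rogawski1990] §2.2 p. 13, §12.3; [Knapp2002] Ch. VI §4; [MoeglinWaldspurger1995] IV.1.11).  (§1) `k ∈ K_∞` commutes with `Φ₃` (`kΦ₃ = Φ₃k`, from
`k^*Φ₃k = Φ₃` and `k^*k = 1`), i.e. `k` is CENTRO-SYMMETRIC: `k₁₀ = k₁₂`, `k₂₀ = k₀₂`, `k₂₂ = k₀₀`, `k₂₁ = k₀₁`; so `k(e₀ − e₂) = u(k)·(e₀ − e₂)` with **`u(k) := k₀₀ − k₀₂`** — the action on the
`(−1)`-eigenline `V₋ = 𝕜(e₀ − e₂)` of `Φ₃`, the `U(1)`-factor of `K_∞ ≅ U(2) × U(1)` —, `|u(k)| = 1`, `u(kk′) = u(k)u(k′)`, and dually for ROWS `ℓ(x·k) = u(k)·ℓ(x)` with the linear functional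
**`ℓ(x) := x₀ − x₂`** (the last-row functional a `u^m`-type section must use: K2E1-p11's FILE 3); `det k = [(k₀₀+k₀₂)k₁₁ − 2k₀₁k₁₀]·u(k)` (= `det₊(k)·u(k)`, `det₊` the `U(2)`-factor).  (§2) For
`g = b·k`, `b` upper triangular: `row₂ g = b₂₂ · row₂ k`, `g₂₀ − g₂₂ = −b₂₂·u(k)`, `‖row₂ g‖² = |b₂₂|²`.  (§3) THE BIG CELL `g = Φ₃·u(X,Z)`, `u(X,Z) = (1 X Z; 0 1 −X̄; 0 0 1)`, `Z + Z̄ + XX̄ = 0`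
(tree chart: `Z = z_w = −|X_w|²∕2 + iB_w s_w`): `row₂ g = (1, X, Z)`, `1 + |X|² + |Z|² = |1 − Z|² = (1 + |X|²∕2)² + (Im Z)²` = ★ (a2)₃'s archimedean height `ARCH_w`
(`coe_borelHeight_weylLongU_heisChart_line_mul_eq_cm_three`; in R90-CS-p03's letters `1 − Z̄ = A_w + iB_w s_w`), `det g = −1`; for `b ∈ B⁺ ∩ G` (diagonal `d > 0`), `k ∈ K_∞`, `g = b·k`:
**`d₂ = |1 − Z|`, `d₀ = |1 − Z|⁻¹`, `d₁ = 1`** (the MODULUS, consistent with ★ (a2)₃), **`u(k) = −(1 − Z)∕|1 − Z|`**, **`det k = −1`**; existence packaged from ★.  (§4) THE DICTIONARY: the 1-dim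
`K_∞`-types are `det^a ⊗ u^c` (on `T ∩ K_∞ = {diag(α, β, α)}`: `α^{2a+c} β^a`, so the Borel datum `(χ₁,χ₂)_w|_{T∩K} = (α^{m₁}, β^{m₂})` is extended by `a = m₂`, `c = m₁ − 2m₂`), and on the cell
**`det(k)^a · u(k)^c = (−1)^{a+c} · ((1 − Z)∕|1 − Z|)^c`**: the archimedean weight of a 1-dim `K_∞`-type section is a power of ONE phase `(1−Z)∕|1−Z| = \overline{(A+iBs)}∕|A+iBs|` — R90-CS-p03's
(4b) Beta integrand with `m_w = −c = 2m₂ − m₁` up to the constant sign — and carries NO `X_w`-phase (that phase lives in the matrix coefficients of `k|_{V₊} ∈ U(2)`, i.e. higher `K_∞`-types).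
HONEST LABEL: HC_CM is proved only modulo the 7 printed citations (2 remaining named inputs: hLiu418 = `stmt-HodgeConjecture-24832`, h413 = `stmt-HodgeConjecture-24833`) until rung 0
closes; REL ≠ ★ ≠ BUILT; this file asserts no named fact and closes no socket; count-neutral; unconditional matrix algebra over `RCLike`.

## References
* [Rogawski1990] J. D. Rogawski, *Automorphic Representations of Unitary Groups in Three Variables*, Ann. of Math. Stud. 123 (1990): §2.2 p. 13, §12.3 p. 178.
* [Knapp2002] A. W. Knapp, *Lie Groups Beyond an Introduction*, 2nd ed. (2002): Ch. VI §4.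
* [MoeglinWaldspurger1995] C. Mœglin, J.-L. Waldspurger, *Spectral Decomposition and Eisenstein Series* (1995): IV.1.11.
-/

set_option autoImplicit false
set_option linter.dupNamespace false -- the mandated namespace repeats `HodgeConjecture.HodgeConjecture`

noncomputable section

open scoped Matrix ComplexConjugate
open Literature.NumberTheory.Automorphic Literature.NumberTheory.Automorphic.UnitaryGroup
open Summit.HodgeConjecture.HodgeConjecture.Cruxes.H413.K2E1BigCellIwasawaTorusEntrySplitU3 (borel_mul_apply_two weylLong_mul_heis_val)

namespace Summit.HodgeConjecture.HodgeConjecture.Cruxes.H413.K2E1ArchIwasawaKPartU21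

variable {𝕜 : Type*} [RCLike 𝕜]

/-! ## §1 `K_∞ = U(Φ₃) ∩ U(3)`: commutation with `Φ₃`, centro-symmetry, the `U(1)`-factor `u(k) = k₀₀ − k₀₂` -/

section KInfinity

/-- **`k ∈ K_∞` commutes with `Φ₃`**: `k^*Φ₃k = Φ₃` and `kk^* = 1` give `kΦ₃ = Φ₃k`. [cite: Knapp2002, Ch. VI §4] [cite: Rogawski1990, §2.2 p. 13] -/
theorem mul_antidiagonal_eq_antidiagonal_mul {k : GL (Fin 3) 𝕜} (hkG : k ∈ unitaryGroupOfForm (starRingEnd 𝕜) ((StdForm.antidiagonal 3).over 𝕜))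
    (hkU : (k : Matrix (Fin 3) (Fin 3) 𝕜) ∈ Matrix.unitaryGroup (Fin 3) 𝕜) :
    (k : Matrix (Fin 3) (Fin 3) 𝕜) * (StdForm.antidiagonal 3).over 𝕜 = (StdForm.antidiagonal 3).over 𝕜 * (k : Matrix (Fin 3) (Fin 3) 𝕜) := by
  have h1 := mem_unitaryGroupOfForm_starRingEnd_iff.1 hkG
  have h2 : (k : Matrix (Fin 3) (Fin 3) 𝕜) * star (k : Matrix (Fin 3) (Fin 3) 𝕜) = 1 := Matrix.mem_unitaryGroup_iff.1 hkU
  calc (k : Matrix (Fin 3) (Fin 3) 𝕜) * (StdForm.antidiagonal 3).over 𝕜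
      = (k : Matrix (Fin 3) (Fin 3) 𝕜) * (star (k : Matrix (Fin 3) (Fin 3) 𝕜) * (StdForm.antidiagonal 3).over 𝕜 * (k : Matrix (Fin 3) (Fin 3) 𝕜)) := by rw [h1]
    _ = ((k : Matrix (Fin 3) (Fin 3) 𝕜) * star (k : Matrix (Fin 3) (Fin 3) 𝕜)) * (StdForm.antidiagonal 3).over 𝕜 * (k : Matrix (Fin 3) (Fin 3) 𝕜) := by
        simp only [Matrix.mul_assoc]
    _ = (StdForm.antidiagonal 3).over 𝕜 * (k : Matrix (Fin 3) (Fin 3) 𝕜) := by rw [h2, Matrix.one_mul]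

/-- **CENTRO-SYMMETRY of a matrix commuting with `Φ₃`**: `k₁₀ = k₁₂`, `k₂₀ = k₀₂`, `k₂₂ = k₀₀`, `k₂₁ = k₀₁` (`(kΦ₃)ᵢⱼ = kᵢ,₂₋ⱼ`, `(Φ₃k)ᵢⱼ = k₂₋ᵢ,ⱼ`). [cite: Knapp2002, Ch. VI §4] -/
theorem centro_of_mul_antidiagonal_eq {k : Matrix (Fin 3) (Fin 3) 𝕜} (h : k * (StdForm.antidiagonal 3).over 𝕜 = (StdForm.antidiagonal 3).over 𝕜 * k) :
    k 1 0 = k 1 2 ∧ k 2 0 = k 0 2 ∧ k 2 2 = k 0 0 ∧ k 2 1 = k 0 1 := by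
  rw [Literature.NumberTheory.QuadraticForms.HermitianUnimodularRamified.antidiagonal_three_over] at h
  have e := fun i j => congrFun (congrFun h i) j
  have e10 := e 1 0; have e00 := e 0 0; have e02 := e 0 2; have e01 := e 0 1
  simp [Matrix.mul_apply, Fin.sum_univ_three] at e10 e00 e02 e01
  exact ⟨e10.symm, e00.symm, e02.symm, e01.symm⟩

/-- **`k(e₀ − e₂) = u(k)·(e₀ − e₂)`, entrywise**: for `k` commuting with `Φ₃`, `k₁₀ − k₁₂ = 0` and `k₂₀ − k₂₂ = −(k₀₀ − k₀₂)` — the `(−1)`-eigenline `V₋ = 𝕜(e₀ − e₂)` of `Φ₃` is `k`-stable with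
eigenvalue `u(k) = k₀₀ − k₀₂`, the `U(1)`-factor of `K_∞ ≅ U(2)×U(1)`. [cite: Rogawski1990, §12.3 p. 178] [cite: Knapp2002, Ch. VI §4] -/
theorem apply_sub_apply_of_mul_antidiagonal_eq {k : Matrix (Fin 3) (Fin 3) 𝕜} (h : k * (StdForm.antidiagonal 3).over 𝕜 = (StdForm.antidiagonal 3).over 𝕜 * k) :
    k 1 0 - k 1 2 = 0 ∧ k 2 0 - k 2 2 = -(k 0 0 - k 0 2) := by
  obtain ⟨h1, h2, h3, -⟩ := centro_of_mul_antidiagonal_eq h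
  exact ⟨by rw [h1, sub_self], by rw [h2, h3, neg_sub]⟩

/-- **The last-row functional `ℓ(x) = x₀ − x₂` is a `u`-eigenfunctional**: `ℓ(x·k) = u(k)·ℓ(x)` for every row vector `x` and every `k` commuting with `Φ₃` — the functional a
`u^m`-type LAST-ROW section must be built on (K2E1-p11's FILE 3: `F(row₂ M) = ℓ(row₂ M)^m·‖row₂ M‖^{−m−…}`). [cite: Knapp2002, Ch. VI §4] [cite: Rogawski1990, §12.3 p. 178] -/
theorem vecMul_sub_eq_mul_sub {k : Matrix (Fin 3) (Fin 3) 𝕜} (h : k * (StdForm.antidiagonal 3).over 𝕜 = (StdForm.antidiagonal 3).over 𝕜 * k) (x : Fin 3 → 𝕜) :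
    Matrix.vecMul x k 0 - Matrix.vecMul x k 2 = (k 0 0 - k 0 2) * (x 0 - x 2) := by
  obtain ⟨h1, h2⟩ := apply_sub_apply_of_mul_antidiagonal_eq h
  simp only [Matrix.vecMul, dotProduct, Fin.sum_univ_three]
  linear_combination x 1 * h1 + x 2 * h2

/-- **`u` is multiplicative**: `u(kk′) = u(k)·u(k′)` for `k′` commuting with `Φ₃` (a character of `K_∞`). [cite: Rogawski1990, §12.3 p. 178] -/
theorem uPhase_mul {k k' : Matrix (Fin 3) (Fin 3) 𝕜} (h' : k' * (StdForm.antidiagonal 3).over 𝕜 = (StdForm.antidiagonal 3).over 𝕜 * k') :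
    (k * k') 0 0 - (k * k') 0 2 = (k 0 0 - k 0 2) * (k' 0 0 - k' 0 2) := by
  obtain ⟨h1, h2⟩ := apply_sub_apply_of_mul_antidiagonal_eq h'
  simp only [Matrix.mul_apply, Fin.sum_univ_three]
  linear_combination k 0 1 * h1 + k 0 2 * h2

/-- **`|u(k)| = 1` for `k ∈ K_∞`** (`k^*k = 1` on the columns `0, 2` and centro-symmetry: `2|u|² = ‖col₀ k − col₂ k‖² = 2`). [cite: Knapp2002, Ch. VI §4] -/
theorem norm_uPhase_eq_one {k : Matrix (Fin 3) (Fin 3) 𝕜} (h : k * (StdForm.antidiagonal 3).over 𝕜 = (StdForm.antidiagonal 3).over 𝕜 * k)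
    (hkU : k ∈ Matrix.unitaryGroup (Fin 3) 𝕜) : ‖k 0 0 - k 0 2‖ = 1 := by
  obtain ⟨h1, h2⟩ := apply_sub_apply_of_mul_antidiagonal_eq h
  have hu := Matrix.mem_unitaryGroup_iff'.1 hkU
  have e := fun i j => congrFun (congrFun hu i) j
  have e00 := e 0 0; have e02 := e 0 2; have e20 := e 2 0; have e22 := e 2 2
  simp only [Matrix.mul_apply, Fin.sum_univ_three, Matrix.star_apply, Matrix.one_apply_eq, Matrix.one_apply_ne (by decide : (0 : Fin 3) ≠ 2),
    Matrix.one_apply_ne (by decide : (2 : Fin 3) ≠ 0), ← starRingEnd_apply] at e00 e02 e20 e22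
  -- `Σ_l |k_l0 − k_l2|² = 2` and the column difference is `(u, 0, −u)`
  have hsum : conj (k 0 0 - k 0 2) * (k 0 0 - k 0 2) + conj (k 1 0 - k 1 2) * (k 1 0 - k 1 2) + conj (k 2 0 - k 2 2) * (k 2 0 - k 2 2) = 2 := by
    have : conj (k 0 0 - k 0 2) * (k 0 0 - k 0 2) + conj (k 1 0 - k 1 2) * (k 1 0 - k 1 2) + conj (k 2 0 - k 2 2) * (k 2 0 - k 2 2) =
        (conj (k 0 0) * k 0 0 + conj (k 1 0) * k 1 0 + conj (k 2 0) * k 2 0) - (conj (k 0 0) * k 0 2 + conj (k 1 0) * k 1 2 + conj (k 2 0) * k 2 2)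
          - (conj (k 0 2) * k 0 0 + conj (k 1 2) * k 1 0 + conj (k 2 2) * k 2 0) + (conj (k 0 2) * k 0 2 + conj (k 1 2) * k 1 2 + conj (k 2 2) * k 2 2) := by
      simp only [map_sub]; ring
    rw [this, e00, e02, e20, e22]; norm_num
  rw [h1, h2, map_zero, zero_mul, add_zero, map_neg, neg_mul_neg, RCLike.conj_mul] at hsum
  have h2' : ((‖k 0 0 - k 0 2‖ ^ 2 : ℝ) : 𝕜) = ((1 : ℝ) : 𝕜) := by
    rw [RCLike.ofReal_pow, RCLike.ofReal_one]
    linear_combination hsum / 2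
  have h3 : ‖k 0 0 - k 0 2‖ ^ 2 = 1 := RCLike.ofReal_injective h2'
  nlinarith [norm_nonneg (k 0 0 - k 0 2)]

/-- **`det k = det₊(k)·u(k)`**: for `k` commuting with `Φ₃`, `det k = ((k₀₀ + k₀₂)k₁₁ − 2k₀₁k₁₀)·(k₀₀ − k₀₂)` — `det₊(k) = (k₀₀ + k₀₂)k₁₁ − 2k₀₁k₁₀` is the determinant of `k` on the
`(+1)`-eigenplane `V₊ = ⟨e₀ + e₂, e₁⟩` (basis `e₀+e₂ ↦ (k₀₀+k₀₂)(e₀+e₂) + 2k₁₀e₁`, `e₁ ↦ k₀₁(e₀+e₂) + k₁₁e₁`), the `U(2)`-factor. [cite: Rogawski1990, §12.3 p. 178] -/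
theorem det_eq_detPlus_mul_uPhase {k : Matrix (Fin 3) (Fin 3) 𝕜} (h : k * (StdForm.antidiagonal 3).over 𝕜 = (StdForm.antidiagonal 3).over 𝕜 * k) :
    k.det = ((k 0 0 + k 0 2) * k 1 1 - 2 * k 0 1 * k 1 0) * (k 0 0 - k 0 2) := by
  obtain ⟨h1, h2, h3, h4⟩ := centro_of_mul_antidiagonal_eq h
  rw [Matrix.det_fin_three, h2, h3, h4, ← h1]
  ring

/-- **The compact torus `T ∩ K_∞ = {diag(α, β, α)}`**: on a diagonal matrix commuting with `Φ₃` (so `t₂₂ = t₀₀`), `u = t₀₀` and `det = t₀₀² t₁₁`; hence the 1-dim `K_∞`-type `det^a ⊗ u^c`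
restricts to `α^{2a+c} β^a` — it extends the Borel datum `(α^{m₁}, β^{m₂})` iff `a = m₂`, `c = m₁ − 2m₂`. [cite: Rogawski1990, §12.3 p. 178] -/
theorem uPhase_det_diagonal (t : Fin 3 → 𝕜) (h02 : t 2 = t 0) :
    (Matrix.diagonal t 0 0 - Matrix.diagonal t 0 2 = t 0) ∧ (Matrix.diagonal t).det = t 0 ^ 2 * t 1 := by
  refine ⟨by rw [Matrix.diagonal_apply_eq, Matrix.diagonal_apply_ne _ (by decide : (0 : Fin 3) ≠ 2), sub_zero], ?_⟩
  rw [Matrix.det_diagonal, Fin.prod_univ_three, h02]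
  ring

end KInfinity

/-! ## §2 Any factorisation `g = b·k`, `b` upper triangular: the last row and the functional `ℓ` -/

section Factorisation

/-- `g₂₀ − g₂₂ = −b₂₂ · u(k)` for `g = b·k`, `b` upper triangular, `k` commuting with `Φ₃` (`row₂ g = b₂₂ · row₂ k` and `k₂₀ − k₂₂ = −u(k)`). [cite: Knapp2002, Ch. VI §4] -/
theorem apply_two_zero_sub_apply_two_two {b k : GL (Fin 3) 𝕜} (hb : (b : Matrix (Fin 3) (Fin 3) 𝕜).BlockTriangular id)
    (hk : (k : Matrix (Fin 3) (Fin 3) 𝕜) * (StdForm.antidiagonal 3).over 𝕜 = (StdForm.antidiagonal 3).over 𝕜 * (k : Matrix (Fin 3) (Fin 3) 𝕜)) :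
    ((b * k : GL (Fin 3) 𝕜) : Matrix (Fin 3) (Fin 3) 𝕜) 2 0 - ((b * k : GL (Fin 3) 𝕜) : Matrix (Fin 3) (Fin 3) 𝕜) 2 2 =
      -((b : Matrix (Fin 3) (Fin 3) 𝕜) 2 2 * ((k : Matrix (Fin 3) (Fin 3) 𝕜) 0 0 - (k : Matrix (Fin 3) (Fin 3) 𝕜) 0 2)) := by
  obtain ⟨-, h2⟩ := apply_sub_apply_of_mul_antidiagonal_eq hk
  rw [borel_mul_apply_two hb, borel_mul_apply_two hb, ← mul_sub, h2, mul_neg]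

/-- **`‖row₂ g‖² = |b₂₂|²`** for `g = b·k`, `b` upper triangular, `k ∈ U(3)` (the rows of `k` are orthonormal: `(kk^*)₂₂ = 1`). [cite: Knapp2002, Ch. VI §4] -/
theorem norm_sq_row_two_eq {b k : GL (Fin 3) 𝕜} (hb : (b : Matrix (Fin 3) (Fin 3) 𝕜).BlockTriangular id) (hkU : (k : Matrix (Fin 3) (Fin 3) 𝕜) ∈ Matrix.unitaryGroup (Fin 3) 𝕜) :
    ‖((b * k : GL (Fin 3) 𝕜) : Matrix (Fin 3) (Fin 3) 𝕜) 2 0‖ ^ 2 + ‖((b * k : GL (Fin 3) 𝕜) : Matrix (Fin 3) (Fin 3) 𝕜) 2 1‖ ^ 2 + ‖((b * k : GL (Fin 3) 𝕜) : Matrix (Fin 3) (Fin 3) 𝕜) 2 2‖ ^ 2 =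
      ‖(b : Matrix (Fin 3) (Fin 3) 𝕜) 2 2‖ ^ 2 := by
  have hu := Matrix.mem_unitaryGroup_iff.1 hkU
  have e22 := congrFun (congrFun hu 2) 2
  simp only [Matrix.mul_apply, Fin.sum_univ_three, Matrix.star_apply, Matrix.one_apply_eq, ← starRingEnd_apply, RCLike.mul_conj] at e22
  -- `e22 : ↑‖k₂₀‖² + ↑‖k₂₁‖² + ↑‖k₂₂‖² = 1` in `𝕜`
  have e22' : ‖(k : Matrix (Fin 3) (Fin 3) 𝕜) 2 0‖ ^ 2 + ‖(k : Matrix (Fin 3) (Fin 3) 𝕜) 2 1‖ ^ 2 + ‖(k : Matrix (Fin 3) (Fin 3) 𝕜) 2 2‖ ^ 2 = 1 := by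
    have h1 : (((‖(k : Matrix (Fin 3) (Fin 3) 𝕜) 2 0‖ ^ 2 + ‖(k : Matrix (Fin 3) (Fin 3) 𝕜) 2 1‖ ^ 2 + ‖(k : Matrix (Fin 3) (Fin 3) 𝕜) 2 2‖ ^ 2 : ℝ) : 𝕜)) = ((1 : ℝ) : 𝕜) := by
      rw [RCLike.ofReal_one, ← e22]; push_cast; ring
    exact RCLike.ofReal_injective h1
  rw [borel_mul_apply_two hb, borel_mul_apply_two hb, borel_mul_apply_two hb, norm_mul, norm_mul, norm_mul, mul_pow, mul_pow, mul_pow, ← mul_add, ← mul_add, e22', mul_one]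

end Factorisation

/-! ## §3 The big cell `g = Φ₃ · u(X, Z)`, `Z + Z̄ + XX̄ = 0`: the closed form of the torus modulus and of the `K_∞`-phases -/

section BigCell

/-- **The Heisenberg relation in norms**: `Z + Z̄ + XX̄ = 0` gives `1 + |X|² + |Z|² = |1 − Z|²` (`Re Z = −|X|²∕2`). [cite: Rogawski1990, §2.2 p. 13] -/
theorem one_add_norm_sq_add_norm_sq_eq {X Z : 𝕜} (hrel : Z + conj Z + X * conj X = 0) : 1 + ‖X‖ ^ 2 + ‖Z‖ ^ 2 = ‖1 - Z‖ ^ 2 := by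
  have hre : 2 * RCLike.re Z + ‖X‖ ^ 2 = 0 := by
    have h := congrArg RCLike.re hrel
    rw [map_add, map_add, RCLike.conj_re, RCLike.mul_conj, ← RCLike.ofReal_pow, RCLike.ofReal_re, map_zero] at h
    linarith
  rw [RCLike.norm_sq_eq_def (z := Z), RCLike.norm_sq_eq_def (z := 1 - Z), map_sub, map_sub, RCLike.one_re, RCLike.one_im]
  nlinarith [hre]

/-- **The archimedean height in the `(A, Bs)` letters**: `|1 − Z|² = (1 + |X|²∕2)² + (Im Z)²` (`1 − Z̄ = A + iBs`, `A = 1 + |X|²∕2`, `Bs = Im Z`) — ★ (a2)₃'s factor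
`(1 + ‖X_w‖²∕2)² + (wδ)² s_w²` at the place `w`. [cite: MoeglinWaldspurger1995, IV.1.11] -/
theorem norm_sq_one_sub_eq_arch {X Z : 𝕜} (hrel : Z + conj Z + X * conj X = 0) : ‖1 - Z‖ ^ 2 = (1 + ‖X‖ ^ 2 / 2) ^ 2 + RCLike.im Z ^ 2 := by
  have hre : 2 * RCLike.re Z + ‖X‖ ^ 2 = 0 := by
    have h := congrArg RCLike.re hrel
    rw [map_add, map_add, RCLike.conj_re, RCLike.mul_conj, ← RCLike.ofReal_pow, RCLike.ofReal_re, map_zero] at h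
    linarith
  rw [RCLike.norm_sq_eq_def (z := 1 - Z), map_sub, map_sub, RCLike.one_re, RCLike.one_im]
  nlinarith [hre]

/-- `1 − Z ≠ 0` under the Heisenberg relation (`|1 − Z|² = 1 + |X|² + |Z|² ≥ 1`). [folklore] -/
theorem one_sub_ne_zero {X Z : 𝕜} (hrel : Z + conj Z + X * conj X = 0) : (1 : 𝕜) - Z ≠ 0 := by
  intro h0
  have h := one_add_norm_sq_add_norm_sq_eq hrel
  rw [h0, norm_zero] at h
  nlinarith [norm_nonneg X, norm_nonneg Z]

/-- `det (Φ₃ · u(X,Z)) = −1` (`det Φ₃ = −1`, `det u = 1`). [cite: Rogawski1990, §2.2 p. 13] -/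
theorem det_weylLong_mul_heis {X Y Z : 𝕜} {w₀ n : GL (Fin 3) 𝕜} (hw₀ : (w₀ : Matrix (Fin 3) (Fin 3) 𝕜) = !![(0 : 𝕜), 0, 1; 0, 1, 0; 1, 0, 0])
    (hn : (n : Matrix (Fin 3) (Fin 3) 𝕜) = !![1, X, Z; 0, 1, Y; 0, 0, 1]) :
    ((w₀ * n : GL (Fin 3) 𝕜) : Matrix (Fin 3) (Fin 3) 𝕜).det = -1 := by
  rw [weylLong_mul_heis_val hw₀ hn, Matrix.det_fin_three]
  simp [Matrix.cons_val_zero, Matrix.cons_val_one]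

/-- **An upper triangular element of `U(Φ₃)` with positive real diagonal `d` has `d₁ = 1` and `d₀·d₂ = 1`** (entries `(1,1)` and `(0,2)` of `b^*Φ₃b = Φ₃`: `d₁² = 1`, `d₀d₂ = 1`).
[cite: Rogawski1990, §2.2 p. 13] -/
theorem diag_of_mem_borelPos {b : GL (Fin 3) 𝕜} (hbG : b ∈ unitaryGroupOfForm (starRingEnd 𝕜) ((StdForm.antidiagonal 3).over 𝕜)) (hb : (b : Matrix (Fin 3) (Fin 3) 𝕜).BlockTriangular id)
    {d : Fin 3 → ℝ} (hd : ∀ i, 0 < d i) (hbd : ∀ i, (b : Matrix (Fin 3) (Fin 3) 𝕜) i i = d i) : d 1 = 1 ∧ d 0 * d 2 = 1 := by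
  have h := mem_unitaryGroupOfForm_starRingEnd_iff.1 hbG
  rw [Literature.NumberTheory.QuadraticForms.HermitianUnimodularRamified.antidiagonal_three_over] at h
  have h10 : (b : Matrix (Fin 3) (Fin 3) 𝕜) 1 0 = 0 := hb (by decide)
  have h20 : (b : Matrix (Fin 3) (Fin 3) 𝕜) 2 0 = 0 := hb (by decide)
  have h21 : (b : Matrix (Fin 3) (Fin 3) 𝕜) 2 1 = 0 := hb (by decide)
  have e11 := congrFun (congrFun h 1) 1
  have e02 := congrFun (congrFun h 0) 2
  simp [Matrix.mul_apply, Fin.sum_univ_three, Matrix.star_apply, h10, h20, h21, ← starRingEnd_apply, hbd] at e11 e02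
  -- `e11 : conj ↑(d 1) * ↑(d 1) = 1`, `e02 : conj ↑(d 0) * ↑(d 2) = 1`
  have e11' : d 1 * d 1 = 1 := by exact_mod_cast e11
  have e02' : d 0 * d 2 = 1 := by exact_mod_cast e02
  refine ⟨?_, e02'⟩
  nlinarith [hd 1]

/-- **THE `K_∞`-PART OF THE BIG CELL, CLOSED FORM** — for EVERY factorisation `Φ₃ · u(X,Z) = b · k` with `b ∈ U(Φ₃)` upper triangular of positive real diagonal `d` and `k ∈ U(Φ₃) ∩ U(3) = K_∞`
(one exists: ★ `exists_upperTriangularPos_mul_unitary_of_mem`; it is unique): the MODULUS `d₂ = |1 − Z|`, `d₀ = |1 − Z|⁻¹`, `d₁ = 1` (`|1−Z|² = (1+|X|²∕2)² + (Im Z)²` = ★ (a2)₃'s `ARCH_w`,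
`norm_sq_one_sub_eq_arch`), the `U(1)`-PHASE `u(k) = k₀₀ − k₀₂ = −(1 − Z)∕|1 − Z|`, and `det k = −1`.  (`w₀`, `n` any invertible matrices with the displayed entries — the consumer's own terms.)
[cite: Knapp2002, Ch. VI §4] [cite: Rogawski1990, §2.2 p. 13; §12.3 p. 178] [cite: MoeglinWaldspurger1995, IV.1.11] -/
theorem kPart_bigCell {X Z : 𝕜} (hrel : Z + conj Z + X * conj X = 0) {w₀ n b k : GL (Fin 3) 𝕜}
    (hw₀ : (w₀ : Matrix (Fin 3) (Fin 3) 𝕜) = !![(0 : 𝕜), 0, 1; 0, 1, 0; 1, 0, 0]) (hn : (n : Matrix (Fin 3) (Fin 3) 𝕜) = !![1, X, Z; 0, 1, -conj X; 0, 0, 1])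
    (hbG : b ∈ unitaryGroupOfForm (starRingEnd 𝕜) ((StdForm.antidiagonal 3).over 𝕜)) (hkG : k ∈ unitaryGroupOfForm (starRingEnd 𝕜) ((StdForm.antidiagonal 3).over 𝕜))
    (hb : (b : Matrix (Fin 3) (Fin 3) 𝕜).BlockTriangular id) {d : Fin 3 → ℝ} (hd : ∀ i, 0 < d i) (hbd : ∀ i, (b : Matrix (Fin 3) (Fin 3) 𝕜) i i = d i)
    (hkU : (k : Matrix (Fin 3) (Fin 3) 𝕜) ∈ Matrix.unitaryGroup (Fin 3) 𝕜) (h : w₀ * n = b * k) :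
    d 2 = ‖1 - Z‖ ∧ d 0 = ‖1 - Z‖⁻¹ ∧ d 1 = 1 ∧
      (k : Matrix (Fin 3) (Fin 3) 𝕜) 0 0 - (k : Matrix (Fin 3) (Fin 3) 𝕜) 0 2 = -((1 - Z) / ((‖1 - Z‖ : ℝ) : 𝕜)) ∧
      (k : Matrix (Fin 3) (Fin 3) 𝕜).det = -1 := by
  have hcomm := mul_antidiagonal_eq_antidiagonal_mul hkG hkU
  have hrow := weylLong_mul_heis_val hw₀ hn
  obtain ⟨hd1, hd02⟩ := diag_of_mem_borelPos hbG hb hd hbd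
  -- `d₂ = |1 − Z|` from `‖row₂ g‖² = d₂²`
  have g20 : ((w₀ * n : GL (Fin 3) 𝕜) : Matrix (Fin 3) (Fin 3) 𝕜) 2 0 = 1 := by rw [hrow]; rfl
  have g21 : ((w₀ * n : GL (Fin 3) 𝕜) : Matrix (Fin 3) (Fin 3) 𝕜) 2 1 = X := by rw [hrow]; rfl
  have g22 : ((w₀ * n : GL (Fin 3) 𝕜) : Matrix (Fin 3) (Fin 3) 𝕜) 2 2 = Z := by rw [hrow]; rfl
  have hsq := norm_sq_row_two_eq hb hkU
  rw [← h, g20, g21, g22, norm_one, one_pow, one_add_norm_sq_add_norm_sq_eq hrel, hbd 2, RCLike.norm_ofReal, abs_of_pos (hd 2)] at hsq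
  have hd2 : d 2 = ‖1 - Z‖ := by
    have := (pow_left_inj₀ (norm_nonneg (1 - Z)) (hd 2).le two_ne_zero).1 hsq
    exact this.symm
  have hd0 : d 0 = ‖1 - Z‖⁻¹ := by rw [← hd2]; exact eq_inv_of_mul_eq_one_left hd02
  -- the `U(1)`-phase from `g₂₀ − g₂₂ = 1 − Z = −d₂·u(k)`
  have hne : ((‖1 - Z‖ : ℝ) : 𝕜) ≠ 0 := by
    rw [Ne, RCLike.ofReal_eq_zero, norm_eq_zero]; exact one_sub_ne_zero hrel
  have hu : (k : Matrix (Fin 3) (Fin 3) 𝕜) 0 0 - (k : Matrix (Fin 3) (Fin 3) 𝕜) 0 2 = -((1 - Z) / ((‖1 - Z‖ : ℝ) : 𝕜)) := by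
    have e := apply_two_zero_sub_apply_two_two hb hcomm
    rw [← h, g20, g22, hbd 2, hd2] at e
    rw [← neg_div, eq_div_iff hne]
    linear_combination e
  -- `det k = −1` from `det g = −1`, `det b = d₀d₁d₂ = 1`
  have hdetb : (b : Matrix (Fin 3) (Fin 3) 𝕜).det = 1 := by
    rw [Matrix.det_of_upperTriangular hb, Fin.prod_univ_three, hbd 0, hbd 1, hbd 2, hd1, RCLike.ofReal_one, mul_one, ← RCLike.ofReal_mul, hd02, RCLike.ofReal_one]
  have hdetk : (k : Matrix (Fin 3) (Fin 3) 𝕜).det = -1 := by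
    have e := det_weylLong_mul_heis hw₀ hn
    rw [h, Units.val_mul, Matrix.det_mul, hdetb, one_mul] at e
    exact e
  exact ⟨hd2, hd0, hd1, hu, hdetk⟩

/-- **EXISTENCE, PACKAGED** (★ `exists_upperTriangularPos_mul_unitary_of_mem` + `kPart_bigCell`): for `g ∈ U(Φ₃)(𝕜)` with the matrix of `Φ₃ · u(X,Z)` (`Z + Z̄ + XX̄ = 0`) there are `b, k ∈ U(Φ₃)`,
`b` upper triangular with diagonal `(|1−Z|⁻¹, 1, |1−Z|)` (as positive reals), `k ∈ U(3)`, `g = b·k`, with `u(k) = −(1−Z)∕|1−Z|` and `det k = −1`.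
[cite: Knapp2002, Ch. VI §4] [cite: Rogawski1990, §2.2 p. 13] -/
theorem exists_kPart_bigCell {X Z : 𝕜} (hrel : Z + conj Z + X * conj X = 0) {w₀ n : GL (Fin 3) 𝕜}
    (hw₀ : (w₀ : Matrix (Fin 3) (Fin 3) 𝕜) = !![(0 : 𝕜), 0, 1; 0, 1, 0; 1, 0, 0]) (hn : (n : Matrix (Fin 3) (Fin 3) 𝕜) = !![1, X, Z; 0, 1, -conj X; 0, 0, 1])
    (hg : w₀ * n ∈ unitaryGroupOfForm (starRingEnd 𝕜) ((StdForm.antidiagonal 3).over 𝕜)) :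
    ∃ (b k : GL (Fin 3) 𝕜) (d : Fin 3 → ℝ),
      b ∈ unitaryGroupOfForm (starRingEnd 𝕜) ((StdForm.antidiagonal 3).over 𝕜) ∧ k ∈ unitaryGroupOfForm (starRingEnd 𝕜) ((StdForm.antidiagonal 3).over 𝕜) ∧
      (b : Matrix (Fin 3) (Fin 3) 𝕜).BlockTriangular id ∧ (∀ i, 0 < d i) ∧ (∀ i, (b : Matrix (Fin 3) (Fin 3) 𝕜) i i = d i) ∧
      (k : Matrix (Fin 3) (Fin 3) 𝕜) ∈ Matrix.unitaryGroup (Fin 3) 𝕜 ∧ w₀ * n = b * k ∧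
      d 2 = ‖1 - Z‖ ∧ d 0 = ‖1 - Z‖⁻¹ ∧ d 1 = 1 ∧
      (k : Matrix (Fin 3) (Fin 3) 𝕜) 0 0 - (k : Matrix (Fin 3) (Fin 3) 𝕜) 0 2 = -((1 - Z) / ((‖1 - Z‖ : ℝ) : 𝕜)) ∧
      (k : Matrix (Fin 3) (Fin 3) 𝕜).det = -1 := by
  obtain ⟨b, k, d, hbG, hkG, hb, hd, hbd, hkU, h⟩ := exists_upperTriangularPos_mul_unitary_of_mem hg
  obtain ⟨h2, h0, h1, hu, hdet⟩ := kPart_bigCell hrel hw₀ hn hbG hkG hb hd hbd hkU h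
  exact ⟨b, k, d, hbG, hkG, hb, hd, hbd, hkU, h, h2, h0, h1, hu, hdet⟩

end BigCell

/-! ## §4 THE DICTIONARY: 1-dim `K_∞`-types on the big cell — one phase `(1−Z)∕|1−Z|`, no `X`-phase -/

section Dictionary

/-- **THE ARCHIMEDEAN WEIGHT OF A 1-DIM `K_∞`-TYPE ON THE BIG CELL**: for every factorisation `Φ₃·u(X,Z) = b·k` as in `kPart_bigCell` and all `a c : ℕ`,
`det(k)^a · u(k)^c = (−1)^{a+c} · ((1 − Z)∕|1 − Z|)^c` — a power of the single phase `(1−Z)∕|1−Z| = \overline{(A+iBs)}∕|A+iBs|` (R90-CS-p03's (4b) Beta integrand, `m_w = −c` up to the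
constant sign), with NO dependence on the phase of `X` (negative powers: invert; `|u| = 1`, `det k = −1`). [cite: Rogawski1990, §12.3 p. 178] [cite: MoeglinWaldspurger1995, IV.1.11] -/
theorem det_pow_mul_uPhase_pow_bigCell {X Z : 𝕜} (hrel : Z + conj Z + X * conj X = 0) {w₀ n b k : GL (Fin 3) 𝕜}
    (hw₀ : (w₀ : Matrix (Fin 3) (Fin 3) 𝕜) = !![(0 : 𝕜), 0, 1; 0, 1, 0; 1, 0, 0]) (hn : (n : Matrix (Fin 3) (Fin 3) 𝕜) = !![1, X, Z; 0, 1, -conj X; 0, 0, 1])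
    (hbG : b ∈ unitaryGroupOfForm (starRingEnd 𝕜) ((StdForm.antidiagonal 3).over 𝕜)) (hkG : k ∈ unitaryGroupOfForm (starRingEnd 𝕜) ((StdForm.antidiagonal 3).over 𝕜))
    (hb : (b : Matrix (Fin 3) (Fin 3) 𝕜).BlockTriangular id) {d : Fin 3 → ℝ} (hd : ∀ i, 0 < d i) (hbd : ∀ i, (b : Matrix (Fin 3) (Fin 3) 𝕜) i i = d i)
    (hkU : (k : Matrix (Fin 3) (Fin 3) 𝕜) ∈ Matrix.unitaryGroup (Fin 3) 𝕜) (h : w₀ * n = b * k) (a c : ℕ) :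
    (k : Matrix (Fin 3) (Fin 3) 𝕜).det ^ a * ((k : Matrix (Fin 3) (Fin 3) 𝕜) 0 0 - (k : Matrix (Fin 3) (Fin 3) 𝕜) 0 2) ^ c =
      (-1) ^ (a + c) * ((1 - Z) / ((‖1 - Z‖ : ℝ) : 𝕜)) ^ c := by
  obtain ⟨-, -, -, hu, hdet⟩ := kPart_bigCell hrel hw₀ hn hbG hkG hb hd hbd hkU h
  rw [hdet, hu, neg_eq_neg_one_mul ((1 - Z) / _), mul_pow, pow_add]
  ring

end Dictionary

/-! ## §5 (ED. 2) THE SIGN OF RECORD `ℓ(x) := x₂ − x₀ = x·(e₂ − e₀)` (S8-R157 ∕ S8-R159: `ℓ(row₂ 1) = 1`; on the cell `ℓ(1, X, Z) = Z − 1`) -/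

section SignOfRecord

/-- **`ℓ(x·k) = u(k)·ℓ(x)` for the functional OF RECORD `ℓ(x) = x₂ − x₀`** (S8-R159; `u(k) = k₀₀ − k₀₂` is basis-sign-free): every `k` commuting with `Φ₃`, every row vector `x`.
[cite: Knapp2002, Ch. VI §4] [cite: Rogawski1990, §12.3 p. 178] -/
theorem vecMul_two_sub_vecMul_zero {k : Matrix (Fin 3) (Fin 3) 𝕜} (h : k * (StdForm.antidiagonal 3).over 𝕜 = (StdForm.antidiagonal 3).over 𝕜 * k) (x : Fin 3 → 𝕜) :
    Matrix.vecMul x k 2 - Matrix.vecMul x k 0 = (k 0 0 - k 0 2) * (x 2 - x 0) := by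
  have h1 := vecMul_sub_eq_mul_sub h x
  linear_combination -h1

/-- `ℓ(row₂ 1) = 1` for `ℓ = x₂ − x₀` (the normalisation `Φa 1 = 1` of K2E1-p11's last-row section). [folklore] -/
theorem one_apply_two_two_sub_one_apply_two_zero : (1 : Matrix (Fin 3) (Fin 3) 𝕜) 2 2 - (1 : Matrix (Fin 3) (Fin 3) 𝕜) 2 0 = 1 := by
  rw [Matrix.one_apply_eq, Matrix.one_apply_ne (by decide : (2 : Fin 3) ≠ 0), sub_zero]

/-- **On the big cell `ℓ(row₂ (Φ₃·u(X,Z))) = Z − 1`** (`row₂ = (1, X, Z)`; `= −\overline{(A + iBs)}` in R90-CS-p03's letters), of modulus `‖Z − 1‖ = ‖row₂‖` (`one_add_norm_sq_add_norm_sq_eq`, `norm_sub_rev`).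
[cite: Rogawski1990, §2.2 p. 13] [cite: MoeglinWaldspurger1995, IV.1.11] -/
theorem ell_row_two_bigCell {X Y Z : 𝕜} {w₀ n : GL (Fin 3) 𝕜} (hw₀ : (w₀ : Matrix (Fin 3) (Fin 3) 𝕜) = !![(0 : 𝕜), 0, 1; 0, 1, 0; 1, 0, 0])
    (hn : (n : Matrix (Fin 3) (Fin 3) 𝕜) = !![1, X, Z; 0, 1, Y; 0, 0, 1]) :
    ((w₀ * n : GL (Fin 3) 𝕜) : Matrix (Fin 3) (Fin 3) 𝕜) 2 2 - ((w₀ * n : GL (Fin 3) 𝕜) : Matrix (Fin 3) (Fin 3) 𝕜) 2 0 = Z - 1 := by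
  rw [weylLong_mul_heis_val hw₀ hn]; rfl

/-- **THE `K_∞`-PHASE AND THE DICTIONARY IN THE SIGN OF RECORD**: for every factorisation `Φ₃·u(X,Z) = b·k` as in `kPart_bigCell`, `u(k) = (Z − 1)∕|1 − Z|` — the unit vector of
`ℓ(row₂) = Z − 1` — and `det(k)^a · u(k)^c = (−1)^a · ((Z − 1)∕|1 − Z|)^c` (`a c : ℕ`; the 1-dim `K_∞`-type `det^a ⊗ u^c`, `a = m₂`, `c = m₁ − 2m₂` on `T ∩ K_∞`).
[cite: Rogawski1990, §12.3 p. 178] [cite: Knapp2002, Ch. VI §4] [cite: MoeglinWaldspurger1995, IV.1.11] -/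
theorem uPhase_and_dictionary_signOfRecord {X Z : 𝕜} (hrel : Z + conj Z + X * conj X = 0) {w₀ n b k : GL (Fin 3) 𝕜}
    (hw₀ : (w₀ : Matrix (Fin 3) (Fin 3) 𝕜) = !![(0 : 𝕜), 0, 1; 0, 1, 0; 1, 0, 0]) (hn : (n : Matrix (Fin 3) (Fin 3) 𝕜) = !![1, X, Z; 0, 1, -conj X; 0, 0, 1])
    (hbG : b ∈ unitaryGroupOfForm (starRingEnd 𝕜) ((StdForm.antidiagonal 3).over 𝕜)) (hkG : k ∈ unitaryGroupOfForm (starRingEnd 𝕜) ((StdForm.antidiagonal 3).over 𝕜))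
    (hb : (b : Matrix (Fin 3) (Fin 3) 𝕜).BlockTriangular id) {d : Fin 3 → ℝ} (hd : ∀ i, 0 < d i) (hbd : ∀ i, (b : Matrix (Fin 3) (Fin 3) 𝕜) i i = d i)
    (hkU : (k : Matrix (Fin 3) (Fin 3) 𝕜) ∈ Matrix.unitaryGroup (Fin 3) 𝕜) (h : w₀ * n = b * k) (a c : ℕ) :
    (k : Matrix (Fin 3) (Fin 3) 𝕜) 0 0 - (k : Matrix (Fin 3) (Fin 3) 𝕜) 0 2 = (Z - 1) / ((‖1 - Z‖ : ℝ) : 𝕜) ∧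
      (k : Matrix (Fin 3) (Fin 3) 𝕜).det ^ a * ((k : Matrix (Fin 3) (Fin 3) 𝕜) 0 0 - (k : Matrix (Fin 3) (Fin 3) 𝕜) 0 2) ^ c = (-1) ^ a * ((Z - 1) / ((‖1 - Z‖ : ℝ) : 𝕜)) ^ c := by
  obtain ⟨-, -, -, hu, hdet⟩ := kPart_bigCell hrel hw₀ hn hbG hkG hb hd hbd hkU h
  have hu' : (k : Matrix (Fin 3) (Fin 3) 𝕜) 0 0 - (k : Matrix (Fin 3) (Fin 3) 𝕜) 0 2 = (Z - 1) / ((‖1 - Z‖ : ℝ) : 𝕜) := by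
    rw [hu, ← neg_div, neg_sub]
  exact ⟨hu', by rw [hdet, hu']⟩

end SignOfRecord

end Summit.HodgeConjecture.HodgeConjecture.Cruxes.H413.K2E1ArchIwasawaKPartU21

end
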